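import Mathlib

/-!
# SoloBlind — half-rank of isotropic Clifford multiplication and the spinor degree bound

Solo-blind residency on the Hodge conjecture (K3 × abelian programme), session s32.
Informal source: `run/shared/lean/ideation/HodgeConjecture/solo-blind/work/s32/trace-gauss.md`
(Theorem L = trace–Gauss identities, Lemma S = spinor rank lemma, Theorem N9 = degree ≥ 9 on rank 8).

What is certified here (the finite / linear-algebra skeleton of Lemma S and Theorem N9):

* `ker_eq_range`, `finrank_eq_two_mul` — LEMMA HR: if `c ∘ c = 0` and `c ∘ w + w ∘ c = 2·id`
  (Clifford multiplication by an isotropic vector `v` and by a vector `v'` with `B(v,v') = 1`),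
  then `ker c = range c`, so `dim V = 2 · rank c`: Clifford multiplication by an isotropic vector
  has exactly half rank on every Clifford module.
* `d4_halfspin_weight_split` — the 8 weights `(±½,±½,±½,±½)` with an even number of minus signs
  (a half-spin representation of `so(8)`) split 4 + 4 according to the sign of the first
  coordinate: the `(−1,0)`-part of a half-spin block of `H₁` of the abelian variety is
  4-dimensional per multiplicity.
* `plethysm_dimension_checks` — the dimension identities behind the Sym/Alt placement of the
  vector representation inside `S ⊗ S` used in the table of Lemma S.
* `degree_bound_rank8`, `degree_bound_rank7`, `galois_order_bound` — the final arithmetic: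
  `ℓ = 8·rank μ₀`, `rank μ₀ ≥ 2`, `ℓ ≤ 2N − 2`, `ℓ ≤ 2n` force `N ≥ 9`, `n ≥ 8` (rank 8), and
  `ℓ = 4·rank μ ≥ 8` forces `N ≥ 5` (rank 7); a Galois carrier whose linear action contains `−1`
  has `|G| = n·s` with `s ≥ 2`, hence `|G| ≥ 16`.
-/

namespace Summit.HodgeConjecture.HodgeConjecture.Theorems.SoloBlindIsotropicHalfRank

/-- LEMMA HR (kernel = image). If `c² = 0` and `c w + w c = 2`, with `2 ≠ 0` in the field,
then `ker c = range c`. -/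
theorem ker_eq_range {K V : Type*} [Field K] [AddCommGroup V] [Module K V]
    (c w : V →ₗ[K] V) (h2 : (2 : K) ≠ 0) (hcc : c ∘ₗ c = 0)
    (hcw : c ∘ₗ w + w ∘ₗ c = (2 : K) • LinearMap.id) :
    LinearMap.ker c = LinearMap.range c := by
  apply le_antisymm
  · intro x hx
    rw [LinearMap.mem_ker] at hx
    have h := congrArg (fun f : V →ₗ[K] V => f x) hcw
    simp only [LinearMap.add_apply, LinearMap.comp_apply, LinearMap.smul_apply,
      LinearMap.id_coe, id_eq, hx, map_zero, add_zero] at h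
    refine ⟨(2 : K)⁻¹ • w x, ?_⟩
    rw [map_smul, h, smul_smul, inv_mul_cancel₀ h2, one_smul]
  · rintro _ ⟨y, rfl⟩
    rw [LinearMap.mem_ker]
    have h := congrArg (fun f : V →ₗ[K] V => f y) hcc
    simpa using h

/-- LEMMA HR (half rank). Under the same hypotheses on a finite-dimensional space,
`dim V = 2 · rank c`: Clifford multiplication by an isotropic vector has half rank. -/
theorem finrank_eq_two_mul {K V : Type*} [Field K] [AddCommGroup V] [Module K V]
    [FiniteDimensional K V] (c w : V →ₗ[K] V) (h2 : (2 : K) ≠ 0) (hcc : c ∘ₗ c = 0)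
    (hcw : c ∘ₗ w + w ∘ₗ c = (2 : K) • LinearMap.id) :
    Module.finrank K V = 2 * Module.finrank K (LinearMap.range c) := by
  have h := LinearMap.finrank_range_add_finrank_ker c
  rw [ker_eq_range c w h2 hcc hcw] at h
  omega

/-- The symmetric situation: `w` also has half rank, and the two ranks agree. -/
theorem finrank_range_eq {K V : Type*} [Field K] [AddCommGroup V] [Module K V]
    [FiniteDimensional K V] (c w : V →ₗ[K] V) (h2 : (2 : K) ≠ 0) (hcc : c ∘ₗ c = 0)
    (hww : w ∘ₗ w = 0) (hcw : c ∘ₗ w + w ∘ₗ c = (2 : K) • LinearMap.id) :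
    Module.finrank K (LinearMap.range c) = Module.finrank K (LinearMap.range w) := by
  have h1 := finrank_eq_two_mul c w h2 hcc hcw
  have hwc : w ∘ₗ c + c ∘ₗ w = (2 : K) • LinearMap.id := by rw [add_comm]; exact hcw
  have h3 := finrank_eq_two_mul w c h2 hww hwc
  omega

/-- Half-spin weights of `D₄`: among the sign vectors `s : Fin 4 → Bool` (`false` = minus sign)
with an even number of minus signs, exactly 4 have first sign `+` and exactly 4 have first
sign `−`.  Hence the cocharacter `ω₁^∨` splits each half-spin representation of `so(8)` as
4 + 4, i.e. `dim S±⁻ = 4`. -/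
theorem d4_halfspin_weight_split :
    (Finset.univ.filter (fun s : Fin 4 → Bool =>
        (Finset.univ.filter (fun i => s i = false)).card % 2 = 0 ∧ s 0 = true)).card = 4 ∧
    (Finset.univ.filter (fun s : Fin 4 → Bool =>
        (Finset.univ.filter (fun i => s i = false)).card % 2 = 0 ∧ s 0 = false)).card = 4 := by
  decide

/-- Spin weights of `B₃` (`so(7)`, spin representation of dimension 8): among all sign vectors
`s : Fin 3 → Bool`, exactly 4 have first sign `−`; so `dim S⁻ = 4` for rank 7. -/
theorem b3_spin_weight_split :
    (Finset.univ.filter (fun s : Fin 3 → Bool => s 0 = false)).card = 4 := by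
  decide

/-- Dimension identities certifying where the vector representation `Λ¹` sits in `S ⊗ S`
(symmetric vs alternating square) for the spin representations used in the table of Lemma S:
`so(7)`: `Λ²(8) = 28 = 7 + 21` (`Λ¹ ⊕ Λ²`);  `so(9)`: `S²(16) = 136 = 1 + 9 + 126` (`Λ⁰ ⊕ Λ¹ ⊕ Λ⁴`);
`so(11)`: `S²(32) = 528 = 11 + 55 + 462` (`Λ¹ ⊕ Λ² ⊕ Λ⁵`);
`so(13)`: `Λ²(64) = 2016 = 1 + 13 + 715 + 1287` (`Λ⁰ ⊕ Λ¹ ⊕ Λ⁴ ⊕ Λ⁵`);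
`so(10)`: `S²(16) = 136 = 10 + 126` (`Λ¹ ⊕ Λ⁵₊`), `Λ²(16) = 120 = Λ³`. -/
theorem plethysm_dimension_checks :
    Nat.choose 8 2 = Nat.choose 7 1 + Nat.choose 7 2 ∧
    Nat.choose 17 2 = Nat.choose 9 0 + Nat.choose 9 1 + Nat.choose 9 4 ∧
    Nat.choose 33 2 = Nat.choose 11 1 + Nat.choose 11 2 + Nat.choose 11 5 ∧
    Nat.choose 64 2 = Nat.choose 13 0 + Nat.choose 13 1 + Nat.choose 13 4 + Nat.choose 13 5 ∧
    Nat.choose 17 2 = Nat.choose 10 1 + Nat.choose 10 5 / 2 ∧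
    Nat.choose 16 2 = Nat.choose 10 3 := by
  decide

/-- THEOREM N9, arithmetic skeleton (rank 8, `E_T = ℚ`): with `ℓ = 8·ρ` (`ρ = rank μ₀`),
`ρ ≥ d ≥ 2` (the half-spin algebras are `M₄` over a quaternion division algebra, so every
non-zero multiplicity block is an invertible `2 × 2` matrix), `ℓ ≤ 2N − 2` (trace identity (I))
and `ℓ ≤ 2n` (at most rank 2 per distinct branch plane), one gets `N ≥ 9` and `n ≥ 8`. -/
theorem degree_bound_rank8 (N n ℓ ρ d : ℕ) (hℓ : ℓ = 8 * ρ) (hd : 2 ≤ d) (hρ : d ≤ ρ)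
    (hN : ℓ + 2 ≤ 2 * N) (hn : ℓ ≤ 2 * n) : 9 ≤ N ∧ 8 ≤ n := by
  omega

/-- Rank 7 analogue (`E_T = ℚ`): `ℓ = 4·ρ` with `ρ ≥ 2` and `ℓ ≤ 2N − 2`, `ℓ ≤ 2n`
give `N ≥ 5`, `n ≥ 4`. -/
theorem degree_bound_rank7 (N n ℓ ρ : ℕ) (hℓ : ℓ = 4 * ρ) (hρ : 2 ≤ ρ)
    (hN : ℓ + 2 ≤ 2 * N) (hn : ℓ ≤ 2 * n) : 5 ≤ N ∧ 4 ≤ n := by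
  omega

/-- Rank ≥ 10 (`E_T = ℚ`): `ℓ ≥ 32` gives `N ≥ 17`, `n ≥ 16`. -/
theorem degree_bound_rank10 (N n ℓ : ℕ) (hℓ : 32 ≤ ℓ)
    (hN : ℓ + 2 ≤ 2 * N) (hn : ℓ ≤ 2 * n) : 17 ≤ N ∧ 16 ≤ n := by
  omega

/-- Galois carriers: if the group `G` permutes the branch planes with `n` distinct planes and
stabilisers of order `s ≥ 2` (e.g. `−1 ∈ ρ(G)` fixes every plane), then `|G| = n·s ≥ 2n`;
with `n ≥ 8` this gives `|G| ≥ 16`. -/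
theorem galois_order_bound (G n s : ℕ) (hG : G = n * s) (hs : 2 ≤ s) (hn : 8 ≤ n) :
    16 ≤ G := by
  subst hG
  nlinarith

/-- Extremal bookkeeping for `N = 9` on rank 8: `ℓ ≤ 2N − 2 = 16 ≤ ℓ` forces `ℓ = 16` and
`rank μ₀ = 2`; the `2N = 18` branch vectors then span exactly `16 = 2N − 2` dimensions. -/
theorem extremal_rank8 (ℓ ρ : ℕ) (hℓ : ℓ = 8 * ρ) (hρ : 2 ≤ ρ) (h : ℓ + 2 ≤ 2 * 9) :
    ℓ = 16 ∧ ρ = 2 := by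
  omega

end Summit.HodgeConjecture.HodgeConjecture.Theorems.SoloBlindIsotropicHalfRank
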